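import Summits.HodgeConjecture.HodgeConjecture.Theorems.Ring2WeilCoverageWeilGramLevel15SqrtNegFifteen
import HarnessLib

/-!
# Weil-type family coverage — THE COMPONENTS OF THE WEIL-TYPE `ℤ[ζ₁₅]`-FOURFOLDS, IV: `K_d = ℚ(√−15)`, type `𝔮₅`
# (`π₅ = ζ¹³(1 − ζ³)(1 − ζ)`, `(𝔬𝔣₀)⁴ = (5)`): `det a = 18000 = 5·60²` — the NON-SPLIT class `[5] = [2]`, `T = {3, 5}`

research route conditional on HC_CM; not a corollary; Q11.4-sentence-2 already refuted in dim ≥ 3.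

Ring 2, WEIL-TYPE FAMILY-COVERAGE CENSUS (`HOME/WEIL-FAMILY-COVERAGE.md` `## b01`, block b01.46 (C2): «(2, ℚ(√−15),
T = {3,5}) = b01.3's genus class «{3,5} ↦ 2» ([5] = [2]) with the degree-`5` polarisation» — S-pencil there), part 86 of
the `Ring2WeilCoverage*` series; continues parts 83–85 (frame `θ^i`; `s₁₅`, `ξ`).

* §1 the seven traces `Tr(π₅ξ s₁₅ θ^m)` and the Gram datum: **`det a(π₅ξ, s₁₅) = 18000 = 5·60²`** (`= (−5)(−3600)`).
* §2 **EVERY skew `ζ′` of type `𝔮₅` on `ℤ[ζ₁₅]` gives `18000`** (part 82 + THEOREM L (i)); such `Φ`-positive `ζ′` exist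
  for every `ℚ(√−15)`-balanced `Φ` (part 80 `exists_type_fifteen_five_sqrt_neg_fifteen`), folded in as
  `exists_typeFive_sqrtNegFifteen_det`.
* §3 class **`[18000] = [5] ≠ [1]`** in `ℚˣ/Nm(ℚ(√−15)ˣ)` (`5` is a non-square modulo the ramified prime `3`:
  `(5, −15)₃ = −1`; also `(5, −15)₅ = −1`, `T = {3,5}`, and `[5] = [2]` since `10 = Nm((5 + √−15)/2)`): the type-`𝔮₅`
  polarised Weil-type `ℤ[ζ₁₅]`-points for `ℚ(√−15)` lie on the NON-SPLIT component `(2, ℚ(√−15), [5])` = b01.3's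
  genus class «`{3,5}`» — with the right sign `(−1)² det > 0`.

HONEST FRAMING as parts 82–85; `HC_CM` is used nowhere.  No `def`, no named fact, no `sorry`.  Certificates from
`work/py/gen15.py`, re-verified by `linear_combination`.

References: [cite: vanGeemen1994HodgeAV, Lemma 5.2 (2)–(4), 5.4 and (5.4.1)]; [cite: Shimura1998, §14.3 Prop. 4–5,
pp. 103–104]; [cite: Serre1973, Ch. III §1]; census b01.3, b01.46 (C2) (seat-derived).
-/

noncomputable section

open Polynomial NumberField Module
open scoped nonZeroDivisors

namespace Summit.HodgeConjecture.Ring2WeilCoverage.WeilGramLevel15SqrtNegFifteenTypeFive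

open Literature.AlgebraicGeometry.VanGeemen1994 (weilField weilNormResidueGroup)
open Literature.AlgebraicGeometry.Motives (CMType normUnitsSubgroup)
open Literature.NumberTheory.ComplexMultiplication
open Summit.HodgeConjecture.Ring2WeilCoverage.WeilGramCMPoint
open Summit.HodgeConjecture.Ring2WeilCoverage.WeilGramLevel15
open Summit.HodgeConjecture.Ring2WeilCoverage.WeilGramLevel15SqrtNegFifteen
open Summit.HodgeConjecture.Ring2WeilCoverage.RealUnitNormHalfSystems (complexConj_eq_inv)
open Summit.HodgeConjecture.Ring2WeilCoverage.CyclotomicDifferent (isOfType_one_xi_top xi_ne_zero)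
open Summit.HodgeConjecture.Ring2WeilCoverage.RamifiedTypes (isOfType_one_gen_mul_xi complexConj_gen_mul_xi gen_ne_zero)
open Summit.HodgeConjecture.Ring2WeilCoverage.RamifiedTypesLevel15
open Summit.HodgeConjecture.Ring2WeilCoverage.RealUnitNormAllLevels (norm_realUnits_pos_fifteen)
open Summit.HodgeConjecture.HodgeConjecture.Ring2.WeilCoverage (mk_ne_split_of_even mk_eq_split_of_even
  natCast_not_mem_normUnitsSubgroup_of_inert natCast_not_mem_normUnitsSubgroup_of_ramified
  not_mem_normUnitsSubgroup_of_not_exists mem_normUnitsSubgroup_of_sq_add_mul_sq)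
open Summit.HodgeConjecture.HodgeConjecture.Ring2.Hypotheses (splitDiscriminantClass)

variable {K : Type} [Field K] [NumberField K] {ζ : K}

/-- `𝐞(t) = exp(2πi t/n) ∈ ℂ` (`ZMod.toCircle`). -/
local notation3 (prettyPrint := false) "𝐞 " t:max => ((ZMod.toCircle t : Circle) : ℂ)

/-- the residue set `S_Φ` read at level `15`. -/
local notation3 (prettyPrint := false) "SΦ[" Φ "," z "]" =>
  (Finset.univ.filter fun t : ZMod 15 => ∃ σ ∈ (Φ : CMType K).1, σ (z : K) = 𝐞 t)

/-! ### §1 Type `𝔮₅` for `K_d = ℚ(√−15)`: `det a = 18000` -/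

/-- `Tr(ζ′sθ^0) = 4` for `ζ′ = π₅ξ, π₅ = ζ¹³(1 − ζ³)(1 − ζ)`, `s = √−15 = (1 + 2ζ⁵)(1 + 2(ζ³ + ζ¹²))`, `θ = ζ + ζ⁻¹` (Euler evaluation). research route conditional on HC_CM; not a corollary; Q11.4-sentence-2 already refuted in dim ≥ 3. [folklore] -/
theorem trace_piFive_sqrtNegFifteen_zero [IsCyclotomicExtension {15} ℚ K] (hζ : IsPrimitiveRoot ζ 15) :
    Algebra.trace ℚ K ((ζ ^ 13 * (1 - ζ ^ 3) * (1 - ζ) * (ζ ^ 3 * (aeval ζ (derivative (cyclotomic 15 ℚ)))⁻¹)) * ((1 + 2 * ζ ^ 5) * (1 + 2 * (ζ ^ 3 + ζ ^ 12)))) = 4 := by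
  have h15 : ζ ^ 15 = 1 := hζ.pow_eq_one
  have hΦ := cyc_fifteen hζ
  rw [trace_of_key₀ hζ (C (2 : ℚ) + C (-5 : ℚ) * X + C (9 : ℚ) * X ^ 2 + C (-2 : ℚ) * X ^ 3 + C (-5 : ℚ) * X ^ 4 +
      C (5 : ℚ) * X ^ 5 + C (-6 : ℚ) * X ^ 6 + C (4 : ℚ) * X ^ 7) (by compute_degree) (by
    simp only [map_add, map_mul, map_pow, aeval_C, aeval_X, map_neg, eq_ratCast, Rat.cast_ofNat]
    linear_combination ((aeval ζ (derivative (cyclotomic 15 ℚ)))⁻¹ * (-2 + 2 * ζ - 6 * ζ^2 + 2 * ζ^3 + 4 * ζ^5 - 2 * ζ^6)) * hΦ +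
      ((aeval ζ (derivative (cyclotomic 15 ℚ)))⁻¹ * (-ζ + ζ^2 + 4 * ζ^3 - 3 * ζ^4 - ζ^5 - 2 * ζ^6 + 2 * ζ^8 +
        2 * ζ^9 - 2 * ζ^10 - 4 * ζ^12 + 6 * ζ^13 - 2 * ζ^14 - 2 * ζ^16 + 2 * ζ^17 +
        4 * ζ^18 - 4 * ζ^19 - 4 * ζ^21 + 4 * ζ^22)) * h15)]
  norm_num [coeff_X_pow, coeff_X, coeff_C]

/-- `Tr(ζ′sθ^1) = -4` for `ζ′ = π₅ξ, π₅ = ζ¹³(1 − ζ³)(1 − ζ)`, `s = √−15 = (1 + 2ζ⁵)(1 + 2(ζ³ + ζ¹²))`, `θ = ζ + ζ⁻¹` (Euler evaluation). research route conditional on HC_CM; not a corollary; Q11.4-sentence-2 already refuted in dim ≥ 3. [folklore] -/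
theorem trace_piFive_sqrtNegFifteen_one [IsCyclotomicExtension {15} ℚ K] (hζ : IsPrimitiveRoot ζ 15) :
    Algebra.trace ℚ K ((ζ ^ 13 * (1 - ζ ^ 3) * (1 - ζ) * (ζ ^ 3 * (aeval ζ (derivative (cyclotomic 15 ℚ)))⁻¹)) * ((1 + 2 * ζ ^ 5) * (1 + 2 * (ζ ^ 3 + ζ ^ 12))) * (ζ + ζ⁻¹)) = -4 := by
  have h15 : ζ ^ 15 = 1 := hζ.pow_eq_one
  have hΦ := cyc_fifteen hζ
  rw [trace_of_key₁ hζ (C (-7 : ℚ) + C (15 : ℚ) * X + C (-9 : ℚ) * X ^ 2 + C (2 : ℚ) * X ^ 3 + C (5 : ℚ) * X ^ 4 +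
      C (-15 : ℚ) * X ^ 5 + C (11 : ℚ) * X ^ 6 + C (-4 : ℚ) * X ^ 7) (by compute_degree) (by
    simp only [map_add, map_mul, map_pow, aeval_C, aeval_X, map_neg, eq_ratCast, Rat.cast_ofNat]
    linear_combination ((aeval ζ (derivative (cyclotomic 15 ℚ)))⁻¹ * (6 + 10 * ζ - 4 * ζ^2 + 2 * ζ^3 - 6 * ζ^4 - 6 * ζ^6)) * hΦ +
      ((aeval ζ (derivative (cyclotomic 15 ℚ)))⁻¹ * (6 - 3 * ζ + ζ^2 + 3 * ζ^3 - 2 * ζ^4 +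
        3 * ζ^5 - 5 * ζ^6 - ζ^7 + 2 * ζ^9 + 2 * ζ^11 - 6 * ζ^12 + 6 * ζ^13 - 6 * ζ^14 + 6 * ζ^15 - 4 * ζ^16 +
        2 * ζ^17 + 2 * ζ^18 - 2 * ζ^19 + 4 * ζ^20 - 8 * ζ^21 + 4 * ζ^22 - 4 * ζ^23 + 4 * ζ^24)) * h15)]
  norm_num [coeff_X_pow, coeff_X, coeff_C]

/-- `Tr(ζ′sθ^2) = 14` for `ζ′ = π₅ξ, π₅ = ζ¹³(1 − ζ³)(1 − ζ)`, `s = √−15 = (1 + 2ζ⁵)(1 + 2(ζ³ + ζ¹²))`, `θ = ζ + ζ⁻¹` (Euler evaluation). research route conditional on HC_CM; not a corollary; Q11.4-sentence-2 already refuted in dim ≥ 3. [folklore] -/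
theorem trace_piFive_sqrtNegFifteen_two [IsCyclotomicExtension {15} ℚ K] (hζ : IsPrimitiveRoot ζ 15) :
    Algebra.trace ℚ K ((ζ ^ 13 * (1 - ζ ^ 3) * (1 - ζ) * (ζ ^ 3 * (aeval ζ (derivative (cyclotomic 15 ℚ)))⁻¹)) * ((1 + 2 * ζ ^ 5) * (1 + 2 * (ζ ^ 3 + ζ ^ 12))) * (ζ + ζ⁻¹) ^ 2) = 14 := by
  have h15 : ζ ^ 15 = 1 := hζ.pow_eq_one
  have hΦ := cyc_fifteen hζ
  rw [trace_of_key hζ (C (12 : ℚ) + C (-20 : ℚ) * X + C (24 : ℚ) * X ^ 2 + C (-7 : ℚ) * X ^ 3 + C (-10 : ℚ) * X ^ 4 +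
      C (20 : ℚ) * X ^ 5 + C (-26 : ℚ) * X ^ 6 + C (14 : ℚ) * X ^ 7) (by compute_degree) (by
    simp only [map_add, map_mul, map_pow, aeval_C, aeval_X, map_neg, eq_ratCast, Rat.cast_ofNat]
    linear_combination ((aeval ζ (derivative (cyclotomic 15 ℚ)))⁻¹ * (12 + 3 * ζ - 2 * ζ^2 +
        6 * ζ^3 - 10 * ζ^4 - 4 * ζ^5 - 12 * ζ^6)) * hΦ +
      ((aeval ζ (derivative (cyclotomic 15 ℚ)))⁻¹ * (12 - 9 * ζ + 7 * ζ^2 - ζ^4 + 6 * ζ^5 - 7 * ζ^6 +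
        2 * ζ^7 - 5 * ζ^8 + ζ^9 + 4 * ζ^11 - 6 * ζ^12 + 8 * ζ^13 - 12 * ζ^14 + 12 * ζ^15 - 10 * ζ^16 +
        8 * ζ^17 - 2 * ζ^18 + 6 * ζ^20 - 10 * ζ^21 + 8 * ζ^22 - 12 * ζ^23 + 8 * ζ^24 - 4 * ζ^25 +
        4 * ζ^26)) * h15)]
  norm_num [coeff_X_pow, coeff_X, coeff_C]

/-- `Tr(ζ′sθ^3) = -24` for `ζ′ = π₅ξ, π₅ = ζ¹³(1 − ζ³)(1 − ζ)`, `s = √−15 = (1 + 2ζ⁵)(1 + 2(ζ³ + ζ¹²))`, `θ = ζ + ζ⁻¹` (Euler evaluation). research route conditional on HC_CM; not a corollary; Q11.4-sentence-2 already refuted in dim ≥ 3. [folklore] -/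
theorem trace_piFive_sqrtNegFifteen_three [IsCyclotomicExtension {15} ℚ K] (hζ : IsPrimitiveRoot ζ 15) :
    Algebra.trace ℚ K ((ζ ^ 13 * (1 - ζ ^ 3) * (1 - ζ) * (ζ ^ 3 * (aeval ζ (derivative (cyclotomic 15 ℚ)))⁻¹)) * ((1 + 2 * ζ ^ 5) * (1 + 2 * (ζ ^ 3 + ζ ^ 12))) * (ζ + ζ⁻¹) ^ 3) = -24 := by
  have h15 : ζ ^ 15 = 1 := hζ.pow_eq_one
  have hΦ := cyc_fifteen hζ
  rw [trace_of_key hζ (C (-22 : ℚ) + C (50 : ℚ) * X + C (-39 : ℚ) * X ^ 2 + C (12 : ℚ) * X ^ 3 + C (15 : ℚ) * X ^ 4 +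
      C (-50 : ℚ) * X ^ 5 + C (46 : ℚ) * X ^ 6 + C (-24 : ℚ) * X ^ 7) (by compute_degree) (by
    simp only [map_add, map_mul, map_pow, aeval_C, aeval_X, map_neg, eq_ratCast, Rat.cast_ofNat]
    linear_combination ((aeval ζ (derivative (cyclotomic 15 ℚ)))⁻¹ * (20 - ζ + 18 * ζ^2 +
        11 * ζ^3 - 12 * ζ^4 - 6 * ζ^5 - 18 * ζ^6)) * hΦ +
      ((aeval ζ (derivative (cyclotomic 15 ℚ)))⁻¹ * (20 - 21 * ζ + 19 * ζ^2 - 9 * ζ^3 + 6 * ζ^4 +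
        6 * ζ^5 - 8 * ζ^6 + 8 * ζ^7 - 12 * ζ^8 + 3 * ζ^9 - 5 * ζ^10 + 5 * ζ^11 - 6 * ζ^12 +
        12 * ζ^13 - 18 * ζ^14 + 20 * ζ^15 - 22 * ζ^16 + 20 * ζ^17 - 12 * ζ^18 + 8 * ζ^19 + 4 * ζ^20 - 10 * ζ^21 +
        14 * ζ^22 - 22 * ζ^23 + 16 * ζ^24 - 16 * ζ^25 + 12 * ζ^26 - 4 * ζ^27 + 4 * ζ^28)) * h15)]
  norm_num [coeff_X_pow, coeff_X, coeff_C]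

/-- `Tr(ζ′sθ^4) = 44` for `ζ′ = π₅ξ, π₅ = ζ¹³(1 − ζ³)(1 − ζ)`, `s = √−15 = (1 + 2ζ⁵)(1 + 2(ζ³ + ζ¹²))`, `θ = ζ + ζ⁻¹` (Euler evaluation). research route conditional on HC_CM; not a corollary; Q11.4-sentence-2 already refuted in dim ≥ 3. [folklore] -/
theorem trace_piFive_sqrtNegFifteen_four [IsCyclotomicExtension {15} ℚ K] (hζ : IsPrimitiveRoot ζ 15) :
    Algebra.trace ℚ K ((ζ ^ 13 * (1 - ζ ^ 3) * (1 - ζ) * (ζ ^ 3 * (aeval ζ (derivative (cyclotomic 15 ℚ)))⁻¹)) * ((1 + 2 * ζ ^ 5) * (1 + 2 * (ζ ^ 3 + ζ ^ 12))) * (ζ + ζ⁻¹) ^ 4) = 44 := by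
  have h15 : ζ ^ 15 = 1 := hζ.pow_eq_one
  have hΦ := cyc_fifteen hζ
  rw [trace_of_key hζ (C (52 : ℚ) + C (-85 : ℚ) * X + C (84 : ℚ) * X ^ 2 + C (-22 : ℚ) * X ^ 3 + C (-40 : ℚ) * X ^ 4 +
      C (85 : ℚ) * X ^ 5 + C (-96 : ℚ) * X ^ 6 + C (44 : ℚ) * X ^ 7) (by compute_degree) (by
    simp only [map_add, map_mul, map_pow, aeval_C, aeval_X, map_neg, eq_ratCast, Rat.cast_ofNat]
    linear_combination ((aeval ζ (derivative (cyclotomic 15 ℚ)))⁻¹ * (32 - 7 * ζ +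
        32 * ζ^2 - 30 * ζ^3 - 18 * ζ^4 - 7 * ζ^5 - 24 * ζ^6)) * hΦ +
      ((aeval ζ (derivative (cyclotomic 15 ℚ)))⁻¹ * (32 - 39 * ζ + 39 * ζ^2 - 30 * ζ^3 +
        25 * ζ^4 - 3 * ζ^5 - 2 * ζ^6 + 14 * ζ^7 - 20 * ζ^8 + 11 * ζ^9 - 17 * ζ^10 + 8 * ζ^11 - 11 * ζ^12 +
        17 * ζ^13 - 24 * ζ^14 + 32 * ζ^15 - 40 * ζ^16 + 40 * ζ^17 - 34 * ζ^18 + 28 * ζ^19 - 8 * ζ^20 - 2 * ζ^21 +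
        18 * ζ^22 - 32 * ζ^23 + 30 * ζ^24 - 38 * ζ^25 + 28 * ζ^26 - 20 * ζ^27 + 16 * ζ^28 - 4 * ζ^29 +
        4 * ζ^30)) * h15)]
  norm_num [coeff_X_pow, coeff_X, coeff_C]

/-- `Tr(ζ′sθ^5) = -104` for `ζ′ = π₅ξ, π₅ = ζ¹³(1 − ζ³)(1 − ζ)`, `s = √−15 = (1 + 2ζ⁵)(1 + 2(ζ³ + ζ¹²))`, `θ = ζ + ζ⁻¹` (Euler evaluation). research route conditional on HC_CM; not a corollary; Q11.4-sentence-2 already refuted in dim ≥ 3. [folklore] -/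
theorem trace_piFive_sqrtNegFifteen_five [IsCyclotomicExtension {15} ℚ K] (hζ : IsPrimitiveRoot ζ 15) :
    Algebra.trace ℚ K ((ζ ^ 13 * (1 - ζ ^ 3) * (1 - ζ) * (ζ ^ 3 * (aeval ζ (derivative (cyclotomic 15 ℚ)))⁻¹)) * ((1 + 2 * ζ ^ 5) * (1 + 2 * (ζ ^ 3 + ζ ^ 12))) * (ζ + ζ⁻¹) ^ 5) = -104 := by
  have h15 : ζ ^ 15 = 1 := hζ.pow_eq_one
  have hΦ := cyc_fifteen hζ
  rw [trace_of_key hζ (C (-77 : ℚ) + C (180 : ℚ) * X + C (-159 : ℚ) * X ^ 2 + C (52 : ℚ) * X ^ 3 + C (55 : ℚ) * X ^ 4 +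
      C (-180 : ℚ) * X ^ 5 + C (181 : ℚ) * X ^ 6 + C (-104 : ℚ) * X ^ 7) (by compute_degree) (by
    simp only [map_add, map_mul, map_pow, aeval_C, aeval_X, map_neg, eq_ratCast, Rat.cast_ofNat]
    linear_combination ((aeval ζ (derivative (cyclotomic 15 ℚ)))⁻¹ * (49 - 14 * ζ + 57 * ζ^2 - 61 * ζ^3 +
        66 * ζ^4 - 10 * ζ^5 - 35 * ζ^6)) * hΦ +
      ((aeval ζ (derivative (cyclotomic 15 ℚ)))⁻¹ * (49 - 63 * ζ + 71 * ζ^2 - 69 * ζ^3 + 64 * ζ^4 - 33 * ζ^5 +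
        23 * ζ^6 + 11 * ζ^7 - 22 * ζ^8 + 25 * ζ^9 - 37 * ζ^10 + 19 * ζ^11 - 28 * ζ^12 + 25 * ζ^13 - 35 * ζ^14 +
        49 * ζ^15 - 64 * ζ^16 + 72 * ζ^17 - 74 * ζ^18 + 68 * ζ^19 - 42 * ζ^20 + 26 * ζ^21 +
        10 * ζ^22 - 34 * ζ^23 + 48 * ζ^24 - 70 * ζ^25 + 58 * ζ^26 - 58 * ζ^27 + 44 * ζ^28 - 24 * ζ^29 +
        20 * ζ^30 - 4 * ζ^31 + 4 * ζ^32)) * h15)]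
  norm_num [coeff_X_pow, coeff_X, coeff_C]

/-- `Tr(ζ′sθ^6) = 154` for `ζ′ = π₅ξ, π₅ = ζ¹³(1 − ζ³)(1 − ζ)`, `s = √−15 = (1 + 2ζ⁵)(1 + 2(ζ³ + ζ¹²))`, `θ = ζ + ζ⁻¹` (Euler evaluation). research route conditional on HC_CM; not a corollary; Q11.4-sentence-2 already refuted in dim ≥ 3. [folklore] -/
theorem trace_piFive_sqrtNegFifteen_six [IsCyclotomicExtension {15} ℚ K] (hζ : IsPrimitiveRoot ζ 15) :
    Algebra.trace ℚ K ((ζ ^ 13 * (1 - ζ ^ 3) * (1 - ζ) * (ζ ^ 3 * (aeval ζ (derivative (cyclotomic 15 ℚ)))⁻¹)) * ((1 + 2 * ζ ^ 5) * (1 + 2 * (ζ ^ 3 + ζ ^ 12))) * (ζ + ζ⁻¹) ^ 6) = 154 := by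
  have h15 : ζ ^ 15 = 1 := hζ.pow_eq_one
  have hΦ := cyc_fifteen hζ
  rw [trace_of_key hζ (C (207 : ℚ) + C (-340 : ℚ) * X + C (309 : ℚ) * X ^ 2 + C (-77 : ℚ) * X ^ 3 + C (-155 : ℚ) * X ^ 4 +
      C (340 : ℚ) * X ^ 5 + C (-361 : ℚ) * X ^ 6 + C (154 : ℚ) * X ^ 7) (by compute_degree) (by
    simp only [map_add, map_mul, map_pow, aeval_C, aeval_X, map_neg, eq_ratCast, Rat.cast_ofNat]
    linear_combination ((aeval ζ (derivative (cyclotomic 15 ℚ)))⁻¹ * (74 - 24 * ζ + 96 * ζ^2 - 110 * ζ^3 +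
        123 * ζ^4 - 173 * ζ^5 - 63 * ζ^6)) * hΦ +
      ((aeval ζ (derivative (cyclotomic 15 ℚ)))⁻¹ * (74 - 98 * ζ + 120 * ζ^2 - 132 * ζ^3 +
        135 * ζ^4 - 102 * ζ^5 + 87 * ζ^6 - 22 * ζ^7 + ζ^8 + 36 * ζ^9 - 59 * ζ^10 + 44 * ζ^11 - 65 * ζ^12 +
        44 * ζ^13 - 63 * ζ^14 + 74 * ζ^15 - 99 * ζ^16 + 121 * ζ^17 - 138 * ζ^18 + 140 * ζ^19 - 116 * ζ^20 +
        94 * ζ^21 - 32 * ζ^22 - 8 * ζ^23 + 58 * ζ^24 - 104 * ζ^25 + 106 * ζ^26 - 128 * ζ^27 +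
        102 * ζ^28 - 82 * ζ^29 + 64 * ζ^30 - 28 * ζ^31 + 24 * ζ^32 - 4 * ζ^33 + 4 * ζ^34)) * h15)]
  norm_num [coeff_X_pow, coeff_X, coeff_C]

/-- **The Gram datum `a` of `(E_ζ′, s)` in the real frame `θ^i` (`i < 4`)** for `ζ′ = π₅ξ, π₅ = ζ¹³(1 − ζ³)(1 − ζ)` (type 𝔮₅ ((𝔬𝔣₀)⁴ = (5))),
`s = √−15 = (1 + 2ζ⁵)(1 + 2(ζ³ + ζ¹²))`: the integer Hankel matrix `(−Tr(ζ′sθ^{i+j}))ᵢⱼ` (and `b = 0`, part 82 `hb_eq_zero`).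
research route conditional on HC_CM; not a corollary; Q11.4-sentence-2 already refuted in dim ≥ 3. [cite: vanGeemen1994HodgeAV, Lemma 5.2 (2)–(3)] -/
theorem realPart_piFive_sqrtNegFifteen [IsCyclotomicExtension {15} ℚ K] [IsCMField K] (hζ : IsPrimitiveRoot ζ 15)
    {x : Fin 4 → K} (hx : ∀ i, x i = (ζ + ζ⁻¹) ^ (i : ℕ)) {a : Matrix (Fin 4) (Fin 4) ℚ}
    (ha : ∀ i j, a i j = Algebra.trace ℚ K ((ζ ^ 13 * (1 - ζ ^ 3) * (1 - ζ) * (ζ ^ 3 * (aeval ζ (derivative (cyclotomic 15 ℚ)))⁻¹)) * x i * IsCMField.complexConj K (((1 + 2 * ζ ^ 5) * (1 + 2 * (ζ ^ 3 + ζ ^ 12))) * x j))) :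
    a = !![-4, 4, -14, 24; 4, -14, 24, -44; -14, 24, -44, 104; 24, -44, 104, -154] := by
  rw [ha_eq (complexConj_sqrtNegFifteen hζ) (complexConj_thetaFrame hζ hx) ha]
  ext i j
  simp only [Matrix.of_apply, hx, ← pow_add]
  fin_cases i <;> fin_cases j <;> simp [trace_piFive_sqrtNegFifteen_zero hζ, trace_piFive_sqrtNegFifteen_one hζ, trace_piFive_sqrtNegFifteen_two hζ, trace_piFive_sqrtNegFifteen_three hζ, trace_piFive_sqrtNegFifteen_four hζ, trace_piFive_sqrtNegFifteen_five hζ, trace_piFive_sqrtNegFifteen_six hζ]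

/-- **`det a = 18000`** for `ζ′ = π₅ξ, π₅ = ζ¹³(1 − ζ³)(1 − ζ)`, `s = √−15 = (1 + 2ζ⁵)(1 + 2(ζ³ + ζ¹²))` (frame `θ^i`).
research route conditional on HC_CM; not a corollary; Q11.4-sentence-2 already refuted in dim ≥ 3. [cite: vanGeemen1994HodgeAV, Lemma 5.2 (3)] -/
theorem det_realPart_piFive_sqrtNegFifteen [IsCyclotomicExtension {15} ℚ K] [IsCMField K] (hζ : IsPrimitiveRoot ζ 15)
    {x : Fin 4 → K} (hx : ∀ i, x i = (ζ + ζ⁻¹) ^ (i : ℕ)) {a : Matrix (Fin 4) (Fin 4) ℚ}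
    (ha : ∀ i j, a i j = Algebra.trace ℚ K ((ζ ^ 13 * (1 - ζ ^ 3) * (1 - ζ) * (ζ ^ 3 * (aeval ζ (derivative (cyclotomic 15 ℚ)))⁻¹)) * x i * IsCMField.complexConj K (((1 + 2 * ζ ^ 5) * (1 + 2 * (ζ ^ 3 + ζ ^ 12))) * x j))) :
    a.det = 18000 := by
  rw [realPart_piFive_sqrtNegFifteen hζ hx ha]
  simp [Matrix.det_succ_row_zero, Fin.sum_univ_succ, Fin.succAbove, Matrix.submatrix]
  norm_num

/-! ### §2 Invariance and the census form -/

/-- **For EVERY skew `ζ′` of type `𝔮₅` on `ℤ[ζ₁₅]` (`IsOfType 1 ζ′ 𝔣₀`, `𝔬𝔣₀ = (π)`, `(𝔬𝔣₀)⁴ = (5)`; `ζ′ = u·πξ`,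
`u` a real unit of norm `1` by THEOREM L (i) at `15`) the Gram determinant of `(E_ζ′, s₁₅)` in the frame `θ^i` is `18000`**
— for every `Φ` and every `Φ`-positive such `ζ′` (they exist for every `₁₅`… balanced `Φ`, part 80): class `[5]` (`= [2]`; `T = {3, 5}`): b01.3's NON-SPLIT genus class «`{3,5}`» of `ℚ(√−15)`.
research route conditional on HC_CM; not a corollary; Q11.4-sentence-2 already refuted in dim ≥ 3. [cite: vanGeemen1994HodgeAV, Lemma 5.2 (3) and (5.4.1)] [cite: Shimura1998, §14.3 Prop. 4–5, pp. 103–104] -/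
theorem det_realPart_typeFive_sqrtNegFifteen [IsCyclotomicExtension {15} ℚ K] [IsCMField K]
    (hζ : IsPrimitiveRoot ζ 15) {𝔣₀ : Ideal (𝓞 (maximalRealSubfield K))}
    (h𝔣₀ : 𝔣₀.map (algebraMap (𝓞 (maximalRealSubfield K)) (𝓞 K)) = Ideal.span {hζ.toInteger ^ 13 * (1 - hζ.toInteger ^ 3) * (1 - hζ.toInteger ^ 1)})
    {ζ' : K} (hζ' : IsCMField.complexConj K ζ' = -ζ')
    (hT : CMTypeLattice.IsOfType (1 : (FractionalIdeal (𝓞 K)⁰ K)ˣ) ζ' 𝔣₀)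
    {x : Fin 4 → K} (hx : ∀ i, x i = (ζ + ζ⁻¹) ^ (i : ℕ)) {a : Matrix (Fin 4) (Fin 4) ℚ}
    (ha : ∀ i j, a i j = Algebra.trace ℚ K (ζ' * x i * IsCMField.complexConj K (((1 + 2 * ζ ^ 5) * (1 + 2 * (ζ ^ 3 + ζ ^ 12))) * x j))) :
    a.det = 18000 := by
  obtain ⟨ωb, hωb⟩ := exists_basis_thetaPow hζ
  have hx' : ∀ i, x i = (ωb i : K) := fun i => (hx i).trans (hωb i).symm
  have hg : Nat.totient 15 = 2 * (3 + 1) := by rw [totient_fifteen]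
  have hsk : IsCMField.complexConj K (ζ ^ 13 * (1 - ζ ^ 3) * (1 - ζ) * (ζ ^ 3 * (aeval ζ (derivative (cyclotomic 15 ℚ)))⁻¹)) =
      -(ζ ^ 13 * (1 - ζ ^ 3) * (1 - ζ) * (ζ ^ 3 * (aeval ζ (derivative (cyclotomic 15 ℚ)))⁻¹)) := by
    simpa only [pow_one] using complexConj_gen_mul_xi hζ hg adm_fifteen_five
  have h0 : (ζ ^ 13 * (1 - ζ ^ 3) * (1 - ζ) * (ζ ^ 3 * (aeval ζ (derivative (cyclotomic 15 ℚ)))⁻¹)) ≠ 0 :=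
    mul_ne_zero (by simpa only [pow_one] using gen_ne_zero hζ adm_fifteen_five) (xi_ne_zero hζ 3)
  have hT₀ : CMTypeLattice.IsOfType (1 : (FractionalIdeal (𝓞 K)⁰ K)ˣ) (ζ ^ 13 * (1 - ζ ^ 3) * (1 - ζ) * (ζ ^ 3 * (aeval ζ (derivative (cyclotomic 15 ℚ)))⁻¹)) 𝔣₀ := by
    simpa only [pow_one] using isOfType_one_gen_mul_xi hζ 3 ((3, 1, 13) : ℕ × ℕ × ℕ) h𝔣₀
  rw [det_realPart_eq_of_isOfType ωb (complexConj_sqrtNegFifteen hζ) hx' (norm_realUnits_pos_fifteen hζ)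
    hsk h0 hζ' hT₀ hT (fun i j => rfl) ha]
  exact det_realPart_piFive_sqrtNegFifteen hζ hx (fun i j => rfl)

open scoped Classical in
/-- **CENSUS FORM** (part 80's existence + the determinant): for every `ℚ(√−15)`-balanced CM type `Φ` of `ℚ(ζ₁₅)` and the
type `𝔣₀` with `𝔬𝔣₀ = (π)`, `(𝔬𝔣₀)⁴ = (5)`, the torus `ℂ^Φ/Φ(ℤ[ζ₁₅])` carries a `Φ`-positive divisor of type `(K; Φ; 𝔣₀)`, and EVERY
such divisor `X_ζ′` has van Geemen Gram determinant `18000` in the real frame `θ^i`: class `[5]` (`= [2]`; `T = {3, 5}`): b01.3's NON-SPLIT genus class «`{3,5}`» of `ℚ(√−15)`.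
research route conditional on HC_CM; not a corollary; Q11.4-sentence-2 already refuted in dim ≥ 3. [cite: vanGeemen1994HodgeAV, Lemma 5.2 (3) and (5.4.1)] [cite: Shimura1998, §14.3 Prop. 4–5, pp. 103–104] -/
theorem exists_typeFive_sqrtNegFifteen_det [IsCyclotomicExtension {15} ℚ K] [IsCMField K]
    (hζ : IsPrimitiveRoot ζ 15) (Φ : CMType K)
    (hbal : 2 * (SΦ[Φ, ζ] ∩ ({7, 11, 13, 14} : Finset (ZMod 15))).card = (SΦ[Φ, ζ]).card)
    {𝔣₀ : Ideal (𝓞 (maximalRealSubfield K))}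
    (h𝔣₀ : 𝔣₀.map (algebraMap (𝓞 (maximalRealSubfield K)) (𝓞 K)) = Ideal.span {hζ.toInteger ^ 13 * (1 - hζ.toInteger ^ 3) * (1 - hζ.toInteger ^ 1)}) :
    ∃ ζ' : K, IsCMField.complexConj K ζ' = -ζ' ∧ (∀ φ : Φ.1, 0 < (φ.1 ζ').im) ∧
      CMTypeLattice.IsOfType (1 : (FractionalIdeal (𝓞 K)⁰ K)ˣ) ζ' 𝔣₀ ∧
      ∀ (x : Fin 4 → K), (∀ i, x i = (ζ + ζ⁻¹) ^ (i : ℕ)) → ∀ a : Matrix (Fin 4) (Fin 4) ℚ,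
        (∀ i j, a i j = Algebra.trace ℚ K (ζ' * x i * IsCMField.complexConj K (((1 + 2 * ζ ^ 5) * (1 + 2 * (ζ ^ 3 + ζ ^ 12))) * x j))) →
        a.det = 18000 := by
  obtain ⟨ζ', h1, h2, h3⟩ := exists_type_fifteen_five_sqrt_neg_fifteen hζ Φ hbal h𝔣₀
  exact ⟨ζ', h1, h2, h3, fun x hx a ha => det_realPart_typeFive_sqrtNegFifteen hζ h𝔣₀ h1 h3 hx ha⟩

/-! ### §3 Class in `ℚˣ/Nm(ℚ(√−15)ˣ)` -/

/-- **`[18000] = [5] ≠ [1]` in `ℚˣ/Nm(ℚ(√−15)ˣ)`** (`18000 = 5·60²`; `5` is a non-square modulo the ramified prime `3`):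
the type-`𝔮₅` polarised Weil-type `ℤ[ζ₁₅]`-fourfolds lie on the NON-SPLIT component — class `[5]` (`= [2]`; `T = {3, 5}`): b01.3's NON-SPLIT genus class «`{3,5}`» of `ℚ(√−15)`.
research route conditional on HC_CM; not a corollary; Q11.4-sentence-2 already refuted in dim ≥ 3. [cite: vanGeemen1994HodgeAV, 5.4 and (5.4.1)] [cite: Serre1973, Ch. III §1] -/
theorem mk0_det_typeFive_sqrtNegFifteen :
    (QuotientGroup.mk (Units.mk0 (18000 : ℚ) (by norm_num)) : weilNormResidueGroup 15) =
        QuotientGroup.mk (Units.mk0 (5 : ℚ) (by norm_num)) ∧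
      (QuotientGroup.mk (Units.mk0 (5 : ℚ) (by norm_num)) : weilNormResidueGroup 15) ≠
        splitDiscriminantClass 2 15 := by
  constructor
  · rw [QuotientGroup.eq]
    have e : (Units.mk0 (18000 : ℚ) (by norm_num))⁻¹ * Units.mk0 (5 : ℚ) (by norm_num) =
        Units.mk0 ((1 / 3600) : ℚ) (by norm_num) := Units.ext (by norm_num)
    rw [e]
    exact mem_normUnitsSubgroup_of_sq_add_mul_sq _ ((1 / 60) : ℚ) 0 (by norm_num)
  · refine mk_ne_split_of_even (by decide) _ ?_
    have h := natCast_not_mem_normUnitsSubgroup_of_ramified (d := 15) (a := 5) (p := 3) (by norm_num) (by norm_num)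
      (by norm_num) (by decide) (by norm_num)
    simpa using h

end Summit.HodgeConjecture.Ring2WeilCoverage.WeilGramLevel15SqrtNegFifteenTypeFive

end
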